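import Summits.BirchSwinnertonDyer.BirchSwinnertonDyer.Theorems.ManinLocalTwoThreeTwoShiftTransfer
import HarnessLib

/-!
# The 2-adic twin, transfer step II: the compatible pair at an odd level and the conjugation invariance of its restriction
# (route `ManinLocalTwoThree`, cell bsd-f2-manin; crux C2 `ManinOddAtFour` stmt-BirchSwinnertonDyer-22967; LEAD seat p1 gen 12;
# the «index-3 node» of p3's law G₂ `TwoShift.TwoShiftInvariantIsDiamond`, ask A-p3-1)

The `p = 2` twin of p3's `…CubeStepPair.lean` §2–§3, for coefficients in ANY commutative ring `K` and any eigenvalue `ε`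
(so that it serves both G₂ — `K = 𝔽₂`, `ε = 1` — and the «ω-part» of p3's G₈ reduction — `K ⊇ 𝔽₄`, `ε³ = 1`).
Level `M` with `2 ∤ M`, `G = Γ₀(M)` acting on `P¹(𝔽₂)` (`…TwoShiftTransfer.lean`):
* §1 for `φ : Γ₀(2M) → K` additive (`TwoShift.IsAdd`) with `φ(a, 2b; c, d) = ε·φ(a, b; 2c, d)` (`TwoShift.IsShiftEigen ε φ`):
  the coshift character `coshift φ ε = ε·φ(a, b/2; 2c, d)` is additive on `stabZero`, the restriction `restr φ = φ(a, b; c, d)` is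
  additive on `stabInf`, and they AGREE on `kerAct` (`coshift_eq_restr`);
* §2 `Γ₀(M) = T^v · stabZero · T^{-u}` pointwise (`exists_conj_mem_stabZero`), hence the common restriction `ρ = restr φ` to
  `kerAct` is invariant under conjugation by all of `Γ₀(M)` (`restr_conj`); and `stabInf = kerAct · ⟨T⟩` (`exists_kerAct_mul_Tpow`).
Nothing about BSD, Manin's conjecture, C2 or the laws G₂/G₈ is asserted here.  Reference: cell memo HOME/MEMO-es.md §37.9 (the
`p = 3` original) [cite: DarmonDiamondTaylor1995, Lemma 4.28 (p. 135) (shape: degeneracy maps on `Γ₀`)].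
-/

set_option autoImplicit false
set_option linter.dupNamespace false

open scoped MatrixGroups

open CongruenceSubgroup Matrix.SpecialLinearGroup
  Summit.BirchSwinnertonDyer.Rank1Residual.ManinAdditive.NineShiftEqualiser

namespace Summit.BirchSwinnertonDyer.BirchSwinnertonDyer.Theorems.ManinLocalTwoThree

namespace TwoShiftTransfer

open ThreeShiftDescent TwoShift

/-! ### §1. The compatible pair `(coshift φ ε, restr φ)` -/

section Pair

variable {K : Type*} [CommRing K] {M : ℕ}

/-- **The coshift value** `ε·φ(a, b/2; 2c, d)` of `γ = (a b; c d) ∈ Γ₀(M)` when `2 ∣ b` (junk `0` otherwise).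
[folklore] -/
noncomputable def coshift (φ : Gamma0 (2 * M) → K) (ε : K) (γ : Gamma0 M) : K :=
  if h : (2 : ℤ) ∣ ((γ : SL(2, ℤ)) 0 1 : ℤ) then
    ε * φ (g0Of ((γ : SL(2, ℤ)) 0 0) (((γ : SL(2, ℤ)) 0 1 : ℤ) / 2) (2 * (γ : SL(2, ℤ)) 1 0) ((γ : SL(2, ℤ)) 1 1)
      (by
        have hq : ((γ : SL(2, ℤ)) 0 1 : ℤ) / 2 * 2 = (γ : SL(2, ℤ)) 0 1 := Int.ediv_mul_cancel h
        linear_combination gamma0_det_entries γ - ((γ : SL(2, ℤ)) 1 0 : ℤ) * hq)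
      (dvd_two_mul' ((ZMod.intCast_zmod_eq_zero_iff_dvd _ _).mp (Gamma0_mem.mp γ.2))))
  else 0

/-- `coshift` on an explicit matrix `(a, 2b; c, d)`: `ε·φ(a, b; 2c, d)`. [folklore] -/
theorem coshift_g0Of (φ : Gamma0 (2 * M) → K) (ε : K) (a b c d : ℤ) (h : a * d - (2 * b) * c = 1)
    (hc : (M : ℤ) ∣ c) (h' : a * d - b * (2 * c) = 1) (hc' : ((2 * M : ℕ) : ℤ) ∣ 2 * c) :
    coshift φ ε (g0Of a (2 * b) c d h hc) = ε * φ (g0Of a b (2 * c) d h' hc') := by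
  unfold coshift
  rw [dif_pos (show (2 : ℤ) ∣ (((g0Of a (2 * b) c d h hc : Gamma0 M) : SL(2, ℤ)) 0 1 : ℤ) from ⟨b, rfl⟩)]
  congr 2
  exact g0Of_congr rfl (by show (2 * b) / 2 = b; exact Int.mul_ediv_cancel_left b (by norm_num)) rfl rfl _ _ _ _

/-- **The restriction value** `φ(γ)` for `γ ∈ Γ₀(M)` with `2M ∣ c` (junk `0` otherwise). [folklore] -/
noncomputable def restr (φ : Gamma0 (2 * M) → K) (γ : Gamma0 M) : K :=
  if h : ((2 * M : ℕ) : ℤ) ∣ ((γ : SL(2, ℤ)) 1 0 : ℤ) then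
    φ (g0Of ((γ : SL(2, ℤ)) 0 0) ((γ : SL(2, ℤ)) 0 1) ((γ : SL(2, ℤ)) 1 0) ((γ : SL(2, ℤ)) 1 1) (gamma0_det_entries γ) h)
  else 0

/-- `restr` on an explicit matrix with `2M ∣ c`. [folklore] -/
theorem restr_g0Of (φ : Gamma0 (2 * M) → K) (a b c d : ℤ) (h : a * d - b * c = 1)
    (hc : (M : ℤ) ∣ c) (hc' : ((2 * M : ℕ) : ℤ) ∣ c) :
    restr φ (g0Of a b c d h hc) = φ (g0Of a b c d h hc') := by
  unfold restr
  rw [dif_pos (show ((2 * M : ℕ) : ℤ) ∣ (((g0Of a b c d h hc : Gamma0 M) : SL(2, ℤ)) 1 0 : ℤ) from hc')]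
  rfl

variable (φ : Gamma0 (2 * M) → K) (ε : K)

/-- `coshift φ ε` is additive on `stabZero`, for additive `φ`. [folklore] -/
theorem coshift_add (hadd : IsAdd φ) :
    ∀ x ∈ stabZero M, ∀ y ∈ stabZero M, coshift φ ε (x * y) = coshift φ ε x + coshift φ ε y := by
  intro x hx y hy
  obtain ⟨a, b, c, d, h, hc, rfl⟩ := exists_eq_of_mem_stabZero hx
  obtain ⟨a', b', c', d', h', hc', rfl⟩ := exists_eq_of_mem_stabZero hy
  have hcp : (M : ℤ) ∣ c * a' + d * c' := dvd_add (Dvd.dvd.mul_right hc _) (Dvd.dvd.mul_left hc' _)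
  have hprod : (g0Of a (2 * b) c d h hc * g0Of a' (2 * b') c' d' h' hc' : Gamma0 M) =
      g0Of (a * a' + (2 * b) * c') (2 * (a * b' + b * d')) (c * a' + d * c') (c * (2 * b') + d * d')
        (by linear_combination (det_mul_entries h h')) hcp := by
    rw [g0Of_mul a (2 * b) c d a' (2 * b') c' d' h hc h' hc' (det_mul_entries h h') hcp]
    exact g0Of_congr rfl (by ring) rfl rfl _ _ _ _
  have hcp' : ((2 * M : ℕ) : ℤ) ∣ 2 * c * a' + d * (2 * c') := by
    have := dvd_two_mul' hcp
    have e : 2 * (c * a' + d * c') = 2 * c * a' + d * (2 * c') := by ring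
    rwa [e] at this
  rw [hprod, coshift_g0Of φ ε _ _ _ _ _ _ (by linear_combination (det_mul_entries h h')) (dvd_two_mul' hcp),
    coshift_g0Of φ ε a b c d h hc (by linear_combination h) (dvd_two_mul' hc),
    coshift_g0Of φ ε a' b' c' d' h' hc' (by linear_combination h') (dvd_two_mul' hc'), ← mul_add, ← hadd,
    g0Of_mul a b (2 * c) d a' b' (2 * c') d' _ _ _ _ (det_mul_entries (by linear_combination h)
      (by linear_combination h')) hcp']
  congr 2
  exact g0Of_congr (by ring) (by ring) (by ring) (by ring) _ _ _ _

/-- `restr φ` is additive on `stabInf`, for additive `φ`. [folklore] -/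
theorem restr_add (hM2 : ¬ 2 ∣ M) (hadd : IsAdd φ) :
    ∀ x ∈ stabInf M, ∀ y ∈ stabInf M, restr φ (x * y) = restr φ x + restr φ y := by
  intro x hx y hy
  obtain ⟨a, b, c, d, h, hc, hc9, rfl⟩ := exists_eq_of_mem_stabInf hM2 hx
  obtain ⟨a', b', c', d', h', hc', hc9', rfl⟩ := exists_eq_of_mem_stabInf hM2 hy
  have hc9'' : ((2 * M : ℕ) : ℤ) ∣ c * a' + d * c' := dvd_add (Dvd.dvd.mul_right hc9 _) (Dvd.dvd.mul_left hc9' _)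
  rw [g0Of_mul a b c d a' b' c' d' h hc h' hc' (det_mul_entries h h')
      (dvd_add (Dvd.dvd.mul_right hc _) (Dvd.dvd.mul_left hc' _)),
    restr_g0Of φ _ _ _ _ _ _ hc9'', restr_g0Of φ a b c d h hc hc9, restr_g0Of φ a' b' c' d' h' hc' hc9', ← hadd,
    g0Of_mul]

/-- **Agreement on `kerAct`**: `coshift φ ε = restr φ` there, from the `ε`-eigen-invariance of `φ`. [folklore] -/
theorem coshift_eq_restr (hM2 : ¬ 2 ∣ M) (hinv : IsShiftEigen ε φ) :
    ∀ x ∈ kerAct M, coshift φ ε x = restr φ x := by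
  intro x hx
  obtain ⟨a, b, c, d, h, hc, rfl⟩ := exists_eq_of_mem_stabZero (stabZero_of_kerAct hx)
  have hc9 : ((2 * M : ℕ) : ℤ) ∣ c := (mem_stabInf_iff hM2).mp (stabInf_of_kerAct hx)
  rw [coshift_g0Of φ ε a b c d h hc (by linear_combination h) (dvd_two_mul' hc),
    restr_g0Of φ a (2 * b) c d h hc hc9, hinv a b c d (by linear_combination h) hc9]

/-- `restr φ` is invariant under conjugation by `stabInf` on `kerAct`. [folklore] -/
theorem restr_conj_of_mem_stabInf (hM2 : ¬ 2 ∣ M) (hadd : IsAdd φ) {g : Gamma0 M} (hg : g ∈ stabInf M)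
    {x : Gamma0 M} (hx : x ∈ kerAct M) : restr φ (g * x * g⁻¹) = restr φ x := by
  have hxB := stabInf_of_kerAct hx
  rw [restr_add φ hM2 hadd _ ((stabInf M).mul_mem hg hxB) _ ((stabInf M).inv_mem hg),
    restr_add φ hM2 hadd _ hg _ hxB, addOn_map_inv (restr_add φ hM2 hadd) hg]
  abel

/-- `restr φ` is invariant under conjugation by `stabZero` on `kerAct` (via `coshift`). [folklore] -/
theorem restr_conj_of_mem_stabZero (hM2 : ¬ 2 ∣ M) (hadd : IsAdd φ) (hinv : IsShiftEigen ε φ)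
    {g : Gamma0 M} (hg : g ∈ stabZero M) {x : Gamma0 M} (hx : x ∈ kerAct M) :
    restr φ (g * x * g⁻¹) = restr φ x := by
  have hxA := stabZero_of_kerAct hx
  rw [← coshift_eq_restr φ ε hM2 hinv _ (kerAct_conj_mem g hx), ← coshift_eq_restr φ ε hM2 hinv _ hx,
    coshift_add φ ε hadd _ ((stabZero M).mul_mem hg hxA) _ ((stabZero M).inv_mem hg),
    coshift_add φ ε hadd _ hg _ hxA, addOn_map_inv (coshift_add φ ε hadd) hg]
  abel

end Pair

/-! ### §2. `Γ₀(M) = ⟨T⟩ · stabZero · ⟨T⟩` pointwise, conjugation invariance of `ρ`, and `stabInf = kerAct · ⟨T⟩` -/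

section Decompositions

variable {K : Type*} [CommRing K] {M : ℕ}

/-- The cast of `j.val` back to `ZMod 2` (through `ℤ`). [folklore] -/
theorem intCast_val (j : ZMod 2) : (((j.val : ℕ) : ℤ) : ZMod 2) = j := by
  rw [Int.cast_natCast, ZMod.natCast_zmod_val]

/-- **`Γ₀(M) = T^v · Stab(0) · T^{−u}` pointwise**: every `g` has `u, v` with `T^{−v} g T^{u} ∈ stabZero`. [folklore] -/
theorem exists_conj_mem_stabZero (g : Gamma0 M) :
    ∃ u v : ZMod 2, Tpow M (-((v.val : ℕ) : ℤ)) * g * Tpow M ((u.val : ℕ) : ℤ) ∈ stabZero M := by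
  obtain ⟨u, v, huv⟩ := exists_act_some_eq_some (g : SL(2, ℤ))
  refine ⟨u, v, ?_⟩
  rw [mem_stabZero, Subgroup.coe_mul, Subgroup.coe_mul, act_mul, act_mul, act_Tpow_some, zero_add, intCast_val,
    huv, act_Tpow_some, Int.cast_neg, intCast_val, add_neg_cancel]

variable (φ : Gamma0 (2 * M) → K) (ε : K)

/-- **`ρ = restr φ` on `kerAct` is invariant under conjugation by every `g ∈ Γ₀(M)`.** [folklore] -/
theorem restr_conj (hM2 : ¬ 2 ∣ M) (hadd : IsAdd φ) (hinv : IsShiftEigen ε φ)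
    (g : Gamma0 M) {x : Gamma0 M} (hx : x ∈ kerAct M) : restr φ (g * x * g⁻¹) = restr φ x := by
  obtain ⟨u, v, ha⟩ := exists_conj_mem_stabZero g
  set a := Tpow M (-((v.val : ℕ) : ℤ)) * g * Tpow M ((u.val : ℕ) : ℤ) with ha_def
  have hg : g = Tpow M ((v.val : ℕ) : ℤ) * a * Tpow M (-((u.val : ℕ) : ℤ)) := by
    rw [ha_def, ← mul_assoc, ← mul_assoc, Tpow_mul_Tpow, add_neg_cancel, Tpow_zero, one_mul, mul_assoc,
      Tpow_mul_Tpow, add_neg_cancel, Tpow_zero, mul_one]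
  -- the three conjugations
  have h1 : restr φ (Tpow M (-((u.val : ℕ) : ℤ)) * x * (Tpow M (-((u.val : ℕ) : ℤ)))⁻¹) = restr φ x :=
    restr_conj_of_mem_stabInf φ hM2 hadd (Tpow_mem_stabInf _) hx
  set x₁ := Tpow M (-((u.val : ℕ) : ℤ)) * x * (Tpow M (-((u.val : ℕ) : ℤ)))⁻¹ with hx₁
  have hx₁K : x₁ ∈ kerAct M := kerAct_conj_mem _ hx
  have h2 : restr φ (a * x₁ * a⁻¹) = restr φ x₁ := restr_conj_of_mem_stabZero φ ε hM2 hadd hinv ha hx₁K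
  have hx₂K : a * x₁ * a⁻¹ ∈ kerAct M := kerAct_conj_mem _ hx₁K
  have h3 : restr φ (Tpow M ((v.val : ℕ) : ℤ) * (a * x₁ * a⁻¹) * (Tpow M ((v.val : ℕ) : ℤ))⁻¹) =
      restr φ (a * x₁ * a⁻¹) := restr_conj_of_mem_stabInf φ hM2 hadd (Tpow_mem_stabInf _) hx₂K
  have e : g * x * g⁻¹ = Tpow M ((v.val : ℕ) : ℤ) * (a * x₁ * a⁻¹) * (Tpow M ((v.val : ℕ) : ℤ))⁻¹ := by
    rw [hg, hx₁]
    group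
  rw [e, h3, h2, h1]

omit [CommRing K] in
/-- **`stabInf = kerAct · ⟨T⟩`**: every `b ∈ stabInf` is `c · T^k` with `c ∈ kerAct`. [folklore] -/
theorem exists_kerAct_mul_Tpow {b : Gamma0 M} (hb : b ∈ stabInf M) :
    ∃ (k : ℤ) (c : Gamma0 M), c ∈ kerAct M ∧ b = c * Tpow M k := by
  -- `b·0` is a finite point `j`
  have hne : act (b : SL(2, ℤ)) (some 0) ≠ none := fun h => by
    have := act_injective (b : SL(2, ℤ)) (h.trans (mem_stabInf.mp hb).symm)
    exact Option.some_ne_none _ this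
  obtain ⟨j, hj⟩ := Option.ne_none_iff_exists'.mp hne
  refine ⟨((j.val : ℕ) : ℤ), b * Tpow M (-((j.val : ℕ) : ℤ)), ?_, ?_⟩
  · refine kerAct_of_stab ((stabInf M).mul_mem hb (Tpow_mem_stabInf _)) ?_
    have hc : (2 : ℤ) ∣ ((b : SL(2, ℤ)) 1 0 : ℤ) := (act_none_eq_none_iff _).mp hb
    have ht := act_some_of_dvd (b : SL(2, ℤ)) hc
    rw [ht 0, zero_add] at hj
    rw [mem_stabZero, Subgroup.coe_mul, act_mul, act_Tpow_some, zero_add, Int.cast_neg, intCast_val, ht,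
      ← Option.some_injective _ hj, neg_add_cancel]
  · rw [mul_assoc, Tpow_mul_Tpow, neg_add_cancel, Tpow_zero, mul_one]

end Decompositions

end TwoShiftTransfer

end Summit.BirchSwinnertonDyer.BirchSwinnertonDyer.Theorems.ManinLocalTwoThree
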